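import Summits.CriticalPhenomena.SAWScalingLimit.Theorems.SAWDevelopingMapObservableToSLETypeLadderCarvedReductionSqueezeGateStructure
import HarnessLib

/-!
# The lattice-facing facts (MD), (MU) of the inner approximant
# (piece (T-A′₂ inner facts) of stub T-A′₂ `stub_carvedReduction_squeezeGeometry_domainsCore`)

Crux `SAWDevelopingMap.ObservableToSLE` (stmt-CriticalPhenomena-10472), line `six-class-type-ladder`,
stub T-A′₂ `stub_carvedReduction_squeezeGeometry_domainsCore`.  Landing target:
`Summits/CriticalPhenomena/SAWScalingLimit/Theorems/SAWDevelopingMapObservableToSLETypeLadderCarvedReductionSqueezeInnerFacts.lean`.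

The twin's inner-approximant contract (`Squeeze.stub_carvedReduction_innerApproximant`, p144792)
returns `M'` with `closure M' ⊆ Kc ∪ ⋃ i, ball (P i) ρb`, `Kc ⊆ Ω` compact; the limit package
(`TypeLadder.squeeze_limitPackage`, p141874) carves every compact set missing the closed limit
hexagons eventually.  From these two inputs, abstracted:
* `eventually_translate_mem_MD` — (MD): eventually `M' + τ_j ⊆ D` and the `ρg`-discs about the
  pinned gates translate into `D` (compact `Kc + τ` inside the open `D`, `τ_j → τ`; window balls
  inside the realised clean balls `closedBall (P i + τ_j) (ρ/2) ⊆ D`);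
* `eventually_not_mem_MU` — (MU) WITH A FIXED EXEMPTION RADIUS `ρF ≥ ρb`: eventually no removed
  vertex is pinned into `M'` at distance `≥ ρF` from both gates;
* `eventually_strip_MU` — the companion INSIDE the windows: for every `r > 0`, eventually every
  removed vertex pinned into `M'` lies in a window ball `ball (P i) ρb` strictly below height
  `im (P i) + r` (window exactness: removed rows are below the pinned gate, which converges to
  `P i`).
Why a fixed radius: the registered (MU) of T-A′ (`∀ r > 0`, exemption balls of radius `r`) is
unsatisfiable for admissible data — at the gate which the lattice pinning does not align, the top
removed row overshoots the limit line `im = im (P i)` by up to `(2/3)(√3/2) δ_j` plus the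
convergence error, inside the flat window of `E ⊇ M'` (worker log `T-Aprime2-LOG.md` §0); these
two theorems are the corrected clause (MU_F) and its informative form (MU_strip).
Registered carrier: `stub_carvedReduction_innerFacts`.
-/

noncomputable section

open scoped Topology
open Filter Set Metric
open Literature.Probability.LatticeModels (HexVertex hexGraph hexCenter triEmbed Site)
open Literature.Probability.RandomPlanarGeometry

namespace Summit.CriticalPhenomena.SAWScalingLimit.Theorems.ObservableToSLE.TypeLadder

open Summit.CriticalPhenomena.SAWScalingLimit.Theorems.ObservableToSLER.BridgeGate

section Inner

variable {s : ℕ → ℝ} {x : ℕ → Site 2} {U : ℕ → Set HexVertex} {M Kc Ω₀ : Set ℂ} {P : Fin 2 → ℂ}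
  {τ : ℂ} {ρb : ℝ}

/-- **(MD)**: eventually `M + τ_j ⊆ Ω₀` and the closed `ρg`-discs about the gates translate into
`Ω₀`.  Inputs: `closure M ⊆ Kc ∪ ⋃ i, ball (P i) ρb`, `Kc` compact with `Kc + τ ⊆ Ω₀` open,
`τ_j → τ`, and the realised window balls `closedBall (P i + τ_j) ρ₂ ⊆ Ω₀` with `ρb, ρg ≤ ρ₂`. -/
theorem eventually_translate_mem_MD (hΩ : IsOpen Ω₀) (hKc : IsCompact Kc)
    (hKcΩ : ∀ z ∈ Kc, z + τ ∈ Ω₀) (hM : closure M ⊆ Kc ∪ ⋃ i, ball (P i) ρb)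
    (hτ : Tendsto (fun j => (s j : ℂ) * triEmbed (x j)) atTop (𝓝 τ)) {ρ₂ ρg : ℝ} (hb : ρb ≤ ρ₂) (hg : ρg ≤ ρ₂)
    (hballs : ∀ᶠ j in atTop, ∀ i, closedBall (P i + (s j : ℂ) * triEmbed (x j)) ρ₂ ⊆ Ω₀) :
    ∀ᶠ j in atTop, ∀ z : ℂ, (z ∈ M ∨ ∃ i, dist z (P i) ≤ ρg) → z + (s j : ℂ) * triEmbed (x j) ∈ Ω₀ := by
  -- a uniform margin for the compact part
  have hK' : IsCompact ((fun z => z + τ) '' Kc) := hKc.image (continuous_add_const τ)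
  have hK'Ω : (fun z => z + τ) '' Kc ⊆ Ω₀ := by rintro _ ⟨z, hz, rfl⟩; exact hKcΩ z hz
  obtain ⟨ε, hε, hεΩ⟩ := hK'.exists_cthickening_subset_open hΩ hK'Ω
  have h1 : ∀ᶠ j in atTop, dist ((s j : ℂ) * triEmbed (x j)) τ < ε := Metric.tendsto_nhds.1 hτ ε hε
  filter_upwards [h1, hballs] with j hj hjb z hz
  set σ : ℂ := (s j : ℂ) * triEmbed (x j) with hσ
  have hwin : ∀ i, dist z (P i) ≤ ρ₂ → z + σ ∈ Ω₀ := fun i hi =>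
    hjb i (by rw [mem_closedBall, dist_eq_norm, show z + σ - (P i + σ) = z - P i by ring, ← dist_eq_norm]; exact hi)
  rcases hz with hzM | ⟨i, hi⟩
  · rcases hM (subset_closure hzM) with hzK | hzb
    · refine hεΩ (Metric.mem_cthickening_of_dist_le (z + σ) (z + τ) ε _ ⟨z, hzK, rfl⟩ ?_)
      rw [dist_eq_norm, show z + σ - (z + τ) = σ - τ by ring, ← dist_eq_norm]; exact hj.le
    · obtain ⟨i, hi⟩ := mem_iUnion.1 hzb
      exact hwin i ((mem_ball.1 hi).le.trans hb)
  · exact hwin i (hi.trans hg)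

/-- **(MU) with a fixed exemption radius**: if `closure M ⊆ Kc ∪ ⋃ i, ball (P i) ρb` with
`ρb ≤ ρF` and the compact `Kc` is eventually carved (no removed vertex is pinned into it), then
eventually no removed vertex is pinned into `M` at distance `≥ ρF` from both gates. -/
theorem eventually_not_mem_MU (hM : closure M ⊆ Kc ∪ ⋃ i, ball (P i) ρb) {ρF : ℝ} (hbF : ρb ≤ ρF)
    (hcarve : ∀ᶠ j in atTop, ∀ v ∈ U j, (s j : ℂ) * hexCenter v - (s j : ℂ) * triEmbed (x j) ∉ Kc) :
    ∀ᶠ j in atTop, ∀ v : HexVertex, (s j : ℂ) * hexCenter v - (s j : ℂ) * triEmbed (x j) ∈ M →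
      (∀ i, ρF ≤ dist ((s j : ℂ) * hexCenter v - (s j : ℂ) * triEmbed (x j)) (P i)) → v ∉ U j := by
  filter_upwards [hcarve] with j hj v hvM hfar hvU
  rcases hM (subset_closure hvM) with hK | hb
  · exact hj v hvU hK
  · obtain ⟨i, hi⟩ := mem_iUnion.1 hb
    linarith [mem_ball.1 hi, hfar i]

/-- **(MU) inside the windows, the strip form**: with, in addition, exact windows of radius
`r ≥ ρb` at the gates (removed ⟺ row below the gate row, pinned gates `→ P i`), for every `r' > 0`,
eventually, every removed vertex pinned into `M` lies in a window ball `ball (P i) ρb` strictly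
below height `im (P i) + r'`. -/
theorem eventually_strip_MU (hs : ∀ j, 0 < s j) (hM : closure M ⊆ Kc ∪ ⋃ i, ball (P i) ρb)
    (hcarve : ∀ᶠ j in atTop, ∀ v ∈ U j, (s j : ℂ) * hexCenter v - (s j : ℂ) * triEmbed (x j) ∉ Kc)
    {qq : Fin 2 → ℕ → HexVertex} {r : ℝ} (hbr : ρb ≤ r)
    (hconv : ∀ i, Tendsto (fun j => (s j : ℂ) * hexCenter (((qq i j).1 - x j, 0) : HexVertex)) atTop (𝓝 (P i)))
    (hU : ∀ i, ∀ᶠ j in atTop, ∀ v : HexVertex,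
      (s j : ℂ) * hexCenter v - (s j : ℂ) * triEmbed (x j) ∈ ball (P i) r → (v ∈ U j ↔ v.1 1 < (qq i j).1 1))
    {r' : ℝ} (hr' : 0 < r') :
    ∀ᶠ j in atTop, ∀ v ∈ U j, (s j : ℂ) * hexCenter v - (s j : ℂ) * triEmbed (x j) ∈ M →
      ∃ i, (s j : ℂ) * hexCenter v - (s j : ℂ) * triEmbed (x j) ∈ ball (P i) ρb ∧
        ((s j : ℂ) * hexCenter v - (s j : ℂ) * triEmbed (x j)).im < (P i).im + r' := by
  have hgate : ∀ᶠ j in atTop, ∀ i, ((s j : ℂ) * hexCenter (((qq i j).1 - x j, 0) : HexVertex)).im < (P i).im + r' := by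
    rw [eventually_all]
    exact fun i => (Complex.continuous_im.tendsto _ |>.comp (hconv i)).eventually (gt_mem_nhds (by linarith))
  have hbelow : ∀ᶠ j in atTop, ∀ i, ∀ v : HexVertex,
      (s j : ℂ) * hexCenter v - (s j : ℂ) * triEmbed (x j) ∈ ball (P i) r → v ∈ U j →
        ((s j : ℂ) * hexCenter v - (s j : ℂ) * triEmbed (x j)).im <
          ((s j : ℂ) * hexCenter (((qq i j).1 - x j, 0) : HexVertex)).im := by
    rw [eventually_all]; exact fun i => gate_removed_below hs (hU i)
  filter_upwards [hcarve, hgate, hbelow] with j hjc hjg hjb v hvU hvM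
  rcases hM (subset_closure hvM) with hK | hb
  · exact absurd hK (hjc v hvU)
  · obtain ⟨i, hi⟩ := mem_iUnion.1 hb
    refine ⟨i, hi, ?_⟩
    have h1 := hjb i v (ball_subset_ball hbr hi) hvU
    linarith [hjg i]

end Inner

/-- **Registered carrier `stub_carvedReduction_innerFacts`** (crux item stmt-CriticalPhenomena-10472,
stub T-A′₂ `stub_carvedReduction_squeezeGeometry_domainsCore`, piece THE LATTICE-FACING FACTS OF THE
INNER APPROXIMANT): registry form of `eventually_not_mem_MU`. -/
theorem stub_carvedReduction_innerFacts :
    ∀ (s : ℕ → ℝ) (x : ℕ → Site 2) (U : ℕ → Set HexVertex) (M Kc : Set ℂ) (P : Fin 2 → ℂ) (ρb ρF : ℝ),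
      closure M ⊆ Kc ∪ ⋃ i, ball (P i) ρb → ρb ≤ ρF →
      (∀ᶠ j in atTop, ∀ v ∈ U j, (s j : ℂ) * hexCenter v - (s j : ℂ) * triEmbed (x j) ∉ Kc) →
      ∀ᶠ j in atTop, ∀ v : HexVertex, (s j : ℂ) * hexCenter v - (s j : ℂ) * triEmbed (x j) ∈ M →
        (∀ i, ρF ≤ dist ((s j : ℂ) * hexCenter v - (s j : ℂ) * triEmbed (x j)) (P i)) → v ∉ U j :=
  fun _ _ _ _ _ _ _ _ hM hbF hcarve => eventually_not_mem_MU hM hbF hcarve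

end Summit.CriticalPhenomena.SAWScalingLimit.Theorems.ObservableToSLE.TypeLadder

end
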